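import Summits.RiemannHypothesis.RiemannHypothesis.Theorems.TiltedLandingLaw421R3Lens1Pinning
import Summits.RiemannHypothesis.RiemannHypothesis.Theorems.TiltedLandingLaw421R3FarStep5
import Summits.RiemannHypothesis.RiemannHypothesis.Theorems.TiltedLandingLaw421R3ColumnImmunity
import Summits.RiemannHypothesis.RiemannHypothesis.Theorems.TiltedLandingLaw421R3ClusterStep

/-!
# TiltedLandingLaw421R3 — lens-1 (O3-a, director-rh g23): FIRST RUNGS of the law-elect `TopPinning` — PROVED (v2: dirty feet removed)

LENS-1 gen-5 module image `rh33346-cover/lens-1/PinningIso-v2.lean` (v1 d9a2726c + §1b; every v1 declaration byte-identical) (landing target `…/Theorems/TiltedLandingLaw421R3Lens1PinningIso.lean`;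
imports the LANDED `…R3Lens1Pinning` (`RhW08.Lens1Pinning.TopPinning`, (3o)), `…R3FarStep5` (`RhW08.IsolatedTilt.tilt_of_isolated_circle`),
`…R3ColumnImmunity` (`RhW08.Column.abs_im_le_of_level`, `jensenClear_top`, `jensenClear_vline`, `realEntireLt2_of_hyps`) and `…R3ClusterStep`
(`RhW08.QuadW.jensen_host_levelj`, `nlEventOf_of_not_localB`) — checked BY IMPORT, nothing inlined; namespace `RhW08.Lens1PinningIso`;
0 `sorry`, no instances/notation, FQN-cites only).

CONTENT — two PROVED special cases of the OPEN law `RhW08.Lens1Pinning.TopPinning` (its conclusion, verbatim, under extra hypotheses), i.e. the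
BC5-style witnesses that `TopPinning` is neither vacuous nor the crux:

§1 WALSH–JENSEN PINNING (the GEOMETRIC rung, no smallness).  `JensenIsolated f j a`: every OTHER upper zero of `f^{(j)}` has its closed Jensen
   disc DISJOINT from `a`'s closed disc or STRICTLY NESTED inside it (lower nested pairs and real zeros inside the disc are allowed; this implies
   `NoTallerToucher`).  `CleanFeet f j a`: the two feet `Re a ± Im a` of `a`'s circle are neither zeros nor critical points of `f^{(j)}`.
   ★★★ `pinning_of_jensenIsolated`: on a legal frame (`EngineHyps5 2 …`), a Jensen-isolated upper zero `a` of `f^{(j)}` with clean feet has a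
   NON-REAL zero of `f^{(j+1)}` in its closed Jensen disc (`NestedStep a w`) or an NL event `x` with `|x − Re a| < Im a`.  MECHANISM = J. L. Walsh,
   «On the location of the roots of the derivative of a polynomial», Ann. of Math. 22 (1920) §4 (isolated Jensen circle: the roots of `f′` in it are
   counted by the force signs at the feet) in the tree's WINDOW currency: the square window `[Re a − Im a, Re a + Im a] × [−(Hs+1), Hs+1]` of
   `f^{(j)}` is a Jensen `Window` (sides clear by isolation — the `a`-pair itself is clear off the axis with EQUALITY at the feet —, top clear by the
   strip `RhW08.Column.abs_im_le_of_level`), and the tree's local dichotomy `…Splittings.JensenWindow.no_nonreal_zero_of_localA_localB` (Kim 1996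
   Thm 1, window form) forbids «all critical points in the window real ∧ Laguerre sign law on the base» because `a` is a non-real zero IN the window;
   ¬(local B) is an NL event on the base (`RhW08.QuadW.nlEventOf_of_not_localB`); ¬(local A) is a non-real critical point in the window, which
   Jensen's theorem at level `j` (`RhW08.QuadW.jensen_host_levelj`) puts in the closed disc of an upper zero `c` of `f^{(j)}` — `c = a` (done), `c`
   far (impossible: the discs are disjoint and the point is in the window) or `c` nested (its disc lies inside `a`'s).
   `topPinning_case_jensenIsolated`: the literal `TopPinning` conclusion in this case.  `residual_of_not_jensenIsolated`: under `NoTallerToucher`,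
   ¬`JensenIsolated` is EXACTLY a lower-or-equal mate whose closed disc CROSSES OR TOUCHES `a`'s — the typed residual of `TopPinning` after §1
   (crit-1's L★★-killing «partial-overlap theft» population, 0.146 %), plus the finitely many dirty-feet frames.
§1b DIRTY FEET REMOVED (v2).  ★★★ `pinning_of_jensenIsolated'`: the SAME conclusion with the CLOSED base `|x − Re a| ≤ Im a` — the literal
   `TopPinning` disjunction — from `EngineHyps5 2 …`, `f^{(j)} a = 0`, `0 < Im a`, `JensenIsolated f j a` ALONE.  The feet lines are shifted outward
   by a GENERIC `ε ∈ (0, min g m)`: `g` = the UNIFORM slack of the strictly-far zeros (`exists_uniform_far_gap`, hypothesis-free, after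
   `RhW08.SuccB.exists_uniform_gap`), `m` = the NL MARGIN (`exists_nl_margin`: the NL events near the base are finitely many), and `ε` avoids the
   finitely many values putting a corner on a zero of `f^{(j)}`·`f^{(j+1)}` (`RhW08.SuccB.finite_zeros_box`, `Set.Ioo_infinite`); `shifted_clear` =
   side clearance of the shifted lines.  EXACT SPLIT OF THE LAW: `TopPinningCrossing` (OPEN: `TopPinning` on NON-isolated zeros = crossing
   lower-or-equal mates, `residual_of_not_jensenIsolated`) with `topPinning_of_crossing : TopPinningCrossing → TopPinning` and its converse.
§2 WEAK-FIELD PINNING (the head's literal O3-a: port of `RhW08.IsolatedTilt.tilt_of_isolated_circle` to the CLOSED axis disc).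
   ★★ `nl_in_disc_of_weakField`: `f` real, `G := f^{(j)}` holomorphic on `ball (Re a) ρ` (`Im a < ρ`), `a` a SIMPLE zero, `a, ā` the only zeros
   of `G` in the ball, and the COFACTOR FIELD bounded on the punctured ball, `‖G′/G − 2(z − Re a)/q‖ ≤ L` with the exact smallness `Im a · L < 1`
   ⇒ an NL event `x` with `|x − Re a| < Im a` (Rouché on the INNER circle of radius `r = Im a (1 + Im a·L)/2 < Im a`, where `(r² + Im a²)L < 2r`).
   `topPinning_case_weakField`: the literal `TopPinning` conclusion in this case.  (In the weak field the level is Ready′ anyway —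
   `RhW08.IsolatedTilt.aloft_of_not_readyR2` —; the point here is the CLOSED-disc localisation `|x − Re a| < Im a`.)

HONEST LABEL: special cases PROVED ≠ the law; `TopPinning` / `RegUmbrella11S` / 33346 / 33347 stay OPEN; nothing here bears on the truth of RH;
RH is not proved.
-/

namespace RhW08.Lens1PinningIso

open Complex Set Metric
open scoped ComplexConjugate
open Literature.Analysis.Complex
open Summit.RiemannHypothesis.RiemannHypothesis.Theorems.Splittings.JensenWindow
open RhIdea6.G17.W07C7 RhIdea6.G17.W07C7.Rev6 RhIdea6.G18.W07C8.Law421BirthS RhIdea6.G19.W07C11.Seam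
open RhIdea6.G20.W07C12.Frac RhIdea6.G20.W07C12.StColP RhW07.C12.FieldSplit RhIdea6.G21.W07C13.TentMax
open RhW07.C14.TwoSided RhW07.C14.Classes RhW07.C14.Lineage RhW07.C14.Booking
open RhW07.C13.Heredity RhIdea6.G22.W07C15pre.Injection RhW07.E3.Cell RhW07.E3.Lit
open RhW08.Round1 RhW08.StSwap RhW08.Round2 RhW08.QuadW RhW08.SealSwapQ RhW08.SealSwap RhW08.SuccB RhW08.SuccSplit
open RhW08.SuccTheft RhW08.Column RhW08.Hurwitz RhW08.ClusterQ RhW08.ClusterQM RhW08.NewtonDoor RhW08.NewtonDoorGenusOne RhW08.PurseP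
open RhW08.Lens1SignCut RhW08.Lens1Coverage RhW08.IsolatedTilt RhW08.Lens1Pinning

noncomputable section

/-! ## §1 WALSH–JENSEN PINNING: a Jensen-isolated upper zero with clean feet -/

/-- `a` is JENSEN-ISOLATED at level `j`: every other upper zero `c` of `f^{(j)}` has its closed Jensen disc DISJOINT from `a`'s closed disc
(`Im a + Im c < |Re a − Re c|`) or STRICTLY NESTED inside it (`|Re a − Re c| + Im c < Im a`).  [Walsh 1920 §4: «a circle exterior to all the
others»; nested lower pairs added — they do not change the force sign outside `a`'s circle.] -/
def JensenIsolated (f : ℂ → ℂ) (j : ℕ) (a : ℂ) : Prop :=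
  ∀ c : ℂ, iteratedDeriv j f c = 0 → 0 < c.im → c ≠ a → a.im + c.im < |a.re - c.re| ∨ |a.re - c.re| + c.im < a.im

/-- CLEAN FEET: the feet `Re a − Im a`, `Re a + Im a` of `a`'s Jensen circle are neither zeros nor critical points of `f^{(j)}`. -/
def CleanFeet (f : ℂ → ℂ) (j : ℕ) (a : ℂ) : Prop :=
  iteratedDeriv j f ((a.re - a.im : ℝ) : ℂ) ≠ 0 ∧ iteratedDeriv j f ((a.re + a.im : ℝ) : ℂ) ≠ 0 ∧
    iteratedDeriv (j + 1) f ((a.re - a.im : ℝ) : ℂ) ≠ 0 ∧ iteratedDeriv (j + 1) f ((a.re + a.im : ℝ) : ℂ) ≠ 0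

/-- Jensen isolation implies the law's hypothesis `NoTallerToucher` (a strictly taller zero cannot be nested). -/
theorem noTallerToucher_of_jensenIsolated {f : ℂ → ℂ} {j : ℕ} {a : ℂ} (hapos : 0 < a.im) (hJ : JensenIsolated f j a) :
    NoTallerToucher f j a := by
  intro b hb hab
  have hbpos : 0 < b.im := hapos.trans hab
  have hne : b ≠ a := fun h => by rw [h] at hab; exact lt_irrefl _ hab
  rcases hJ b hb hbpos hne with h | h
  · exact h
  · have := abs_nonneg (a.re - b.re); linarith

/-- A Jensen-isolated zero forces `f^{(j)} ≢ 0`. -/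
theorem ne_zero_of_jensenIsolated {f : ℂ → ℂ} {j : ℕ} {a : ℂ} (hapos : 0 < a.im) (hJ : JensenIsolated f j a) :
    iteratedDeriv j f ≠ 0 := by
  intro h0
  have hc : iteratedDeriv j f (a + I) = 0 := by rw [h0]; rfl
  have hne : a + I ≠ a := by
    intro h; have := congrArg Complex.im h; simp at this
  rcases hJ (a + I) hc (by simp; linarith) hne with h | h
  · simp at h; linarith
  · simp at h; linarith

/-- Under `NoTallerToucher`, NOT Jensen-isolated means: a lower-or-equal mate `c ≠ a` whose closed Jensen disc CROSSES OR TOUCHES `a`'s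
(neither disjoint nor strictly nested) — the typed residual of `TopPinning` after §1. -/
theorem residual_of_not_jensenIsolated {f : ℂ → ℂ} {j : ℕ} {a : ℂ} (hN : NoTallerToucher f j a) (hJ : ¬ JensenIsolated f j a) :
    ∃ c : ℂ, iteratedDeriv j f c = 0 ∧ 0 < c.im ∧ c ≠ a ∧ c.im ≤ a.im ∧
      |a.re - c.re| ≤ a.im + c.im ∧ a.im ≤ |a.re - c.re| + c.im := by
  unfold JensenIsolated at hJ
  push Not at hJ
  obtain ⟨c, hc, hcpos, hne, h1, h2⟩ := hJ
  refine ⟨c, hc, hcpos, hne, ?_, h1, h2⟩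
  by_contra hlt
  push Not at hlt
  have := hN c hc hlt
  linarith

/-- Clearance of the two FEET LINES `Re = Re a ± Im a` from every non-real zero of `f^{(j)}` (non-strict; equality for the `a`-pair itself). -/
theorem feet_clear {f : ℂ → ℂ} {j : ℕ} {a : ℂ} (hGreal : ∀ z : ℂ, iteratedDeriv j f (conj z) = conj (iteratedDeriv j f z))
    (hapos : 0 < a.im) (hJ : JensenIsolated f j a) {σ : ℝ} (hσ : σ = 1 ∨ σ = -1) :
    ∀ c : ℂ, iteratedDeriv j f c = 0 → c.im ≠ 0 → |c.im| ≤ |(a.re + σ * a.im) - c.re| := by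
  intro c hc hcim
  -- an upper representative `c'` of the pair `{c, c̄}`
  obtain ⟨c', hc', hc'pos, hc're, hc'im⟩ : ∃ c' : ℂ, iteratedDeriv j f c' = 0 ∧ 0 < c'.im ∧ c'.re = c.re ∧ c'.im = |c.im| := by
    rcases lt_or_gt_of_ne hcim with hneg | hpos
    · refine ⟨conj c, by rw [hGreal, hc, map_zero], by simpa using hneg, by simp, ?_⟩
      rw [Complex.conj_im, abs_of_neg hneg]
    · exact ⟨c, hc, hpos, rfl, (abs_of_pos hpos).symm⟩
  have hσabs : |σ * a.im| = a.im := by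
    rcases hσ with h | h <;> simp [h, abs_of_pos hapos]
  by_cases hca : c' = a
  · -- the `a`-pair: equality
    have hre : c.re = a.re := by rw [← hc're, hca]
    have him : |c.im| = a.im := by rw [← hc'im, hca]
    rw [him, hre, show a.re + σ * a.im - a.re = σ * a.im by ring, hσabs]
  · rcases hJ c' hc' hc'pos hca with hfar | hnest
    · -- far: `Im a + Im c' < |Re a − Re c|`
      rw [hc're] at hfar
      have htri : |a.re - c.re| ≤ |a.re + σ * a.im - c.re| + |σ * a.im| := by
        have := abs_sub_le (a.re - c.re) 0 (-(σ * a.im))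
        have e1 : |a.re - c.re - -(σ * a.im)| = |a.re + σ * a.im - c.re| := by ring_nf
        simpa [abs_neg, e1] using abs_add_le (a.re + σ * a.im - c.re) (-(σ * a.im))
          |>.trans_eq' (by ring_nf)
      rw [hσabs] at htri
      rw [← hc'im]
      linarith
    · -- nested: `|Re a − Re c| + Im c' < Im a`
      rw [hc're] at hnest
      have htri : a.im ≤ |a.re + σ * a.im - c.re| + |a.re - c.re| := by
        have h := abs_add_le (a.re + σ * a.im - c.re) (-(a.re - c.re))
        have e : a.re + σ * a.im - c.re + -(a.re - c.re) = σ * a.im := by ring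
        rw [e, hσabs, abs_neg] at h
        exact h
      rw [← hc'im]
      linarith

/-- ★★★ WALSH–JENSEN PINNING.  On a legal frame, a JENSEN-ISOLATED upper zero `a` of `f^{(j)}` with CLEAN FEET has a non-real zero of `f^{(j+1)}`
in its closed Jensen disc, or an NL event of level `j` strictly inside the base `|x − Re a| < Im a`.  [Walsh, Ann. of Math. 22 (1920) §4; Kim,
PAMS 124 (1996) Thm 1 (window form, tree `…JensenWindow.no_nonreal_zero_of_localA_localB`); Jensen 1913 (tree `RhW08.QuadW.jensen_host_levelj`).] -/
theorem pinning_of_jensenIsolated {η : ℝ} {f : ℂ → ℂ} {x₀ s hmax R Hs : ℝ} {B : ℕ} (hE : EngineHyps5 2 η f x₀ s hmax R Hs B)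
    {j : ℕ} {a : ℂ} (ha : iteratedDeriv j f a = 0) (hapos : 0 < a.im) (hJ : JensenIsolated f j a) (hF : CleanFeet f j a) :
    (∃ w : ℂ, iteratedDeriv (j + 1) f w = 0 ∧ w.im ≠ 0 ∧ NestedStep a w) ∨ (∃ x : ℝ, |x - a.re| < a.im ∧ NLEventOf f j x) := by
  classical
  have hf : RealEntireLt2 f := realEntireLt2_of_hyps hE
  have hnz : iteratedDeriv j f ≠ 0 := ne_zero_of_jensenIsolated hapos hJ
  set G : ℂ → ℂ := iteratedDeriv j f with hGdef
  have hG : RealEntireLt2 G :=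
    { diff := differentiable_iteratedDeriv_of_entire hf.diff j
      growth := by
        obtain ⟨ρ, C, hρ0, hρ, hgr⟩ := hf.growth
        obtain ⟨ρ', C', h1, h2, h3⟩ := exists_growth_iteratedDeriv hf.diff hρ0 hρ hgr j
        exact ⟨ρ', C', h1, h2, h3⟩
      real := im_iteratedDeriv_ofReal hf.diff hf.real j }
  have hGreal : ∀ z : ℂ, G (conj z) = conj (G z) := apply_conj_eq_conj hG.diff hG.real
  have e1 : deriv G = iteratedDeriv (j + 1) f := by rw [hGdef, ← iteratedDeriv_succ]
  have hHs : 0 ≤ Hs := hE.2.2.2.2.2.2.2.1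
  have hstrip : ∀ c : ℂ, G c = 0 → |c.im| ≤ Hs := fun c hc => abs_im_le_of_level hE hnz hc
  have haHs : a.im ≤ Hs := by have := hstrip a ha; rwa [abs_of_pos hapos] at this
  -- the square window of `a`'s disc is a Jensen window
  have hclL : ∀ c : ℂ, G c = 0 → c.im ≠ 0 → |c.im| ≤ |(a.re - a.im) - c.re| := by
    have h := feet_clear (f := f) (j := j) hGreal hapos hJ (σ := -1) (Or.inr rfl)
    simpa [sub_eq_add_neg] using h
  have hclR : ∀ c : ℂ, G c = 0 → c.im ≠ 0 → |c.im| ≤ |(a.re + a.im) - c.re| := by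
    have h := feet_clear (f := f) (j := j) hGreal hapos hJ (σ := 1) (Or.inl rfl)
    simpa using h
  have hW : Window G (a.re - a.im) (a.re + a.im) (Hs + 1) := by
    refine ⟨by linarith, by linarith, ?_, ?_, ?_, hF.1, hF.2.1, ?_, ?_⟩
    · exact fun x _ => jensenClear_top (by linarith) (by linarith) hstrip
    · exact fun y _ hy0 => jensenClear_vline hy0 hclL
    · exact fun y _ hy0 => jensenClear_vline hy0 hclR
    · rw [e1]; exact hF.2.2.1
    · rw [e1]; exact hF.2.2.2
  have hamem : a ∈ Ioo (a.re - a.im) (a.re + a.im) ×ℂ Ioo (-(Hs + 1)) (Hs + 1) :=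
    mem_reProdIm.2 ⟨⟨by linarith, by linarith⟩, ⟨by linarith, by linarith⟩⟩
  by_cases hB : LocalB G (a.re - a.im) (a.re + a.im)
  · by_cases hA : LocalA G (a.re - a.im) (a.re + a.im) (Hs + 1)
    · exact absurd (no_nonreal_zero_of_localA_localB hG hW hA hB a hamem ha) hapos.ne'
    · -- a non-real critical point in the window; make it upper
      unfold LocalA at hA
      push Not at hA
      obtain ⟨ρ, hρ, hdρ, hρim⟩ := hA
      have hdreal : ∀ x : ℝ, (deriv G x).im = 0 := im_deriv_ofReal hG.diff hG.real
      obtain ⟨w, hw, hdw, hwpos⟩ : ∃ w ∈ Ioo (a.re - a.im) (a.re + a.im) ×ℂ Ioo (-(Hs + 1)) (Hs + 1), deriv G w = 0 ∧ 0 < w.im := by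
        rcases lt_or_gt_of_ne hρim with hneg | hpos
        · refine ⟨conj ρ, ?_, ?_, ?_⟩
          · rw [mem_reProdIm] at hρ ⊢
            obtain ⟨h1, h2, h3⟩ := hρ
            refine ⟨by simpa using h1, ?_, ?_⟩
            · simp only [Complex.conj_im]; linarith [h3]
            · simp only [Complex.conj_im]; linarith [h2]
          · rw [apply_conj_eq_conj hG.diff.deriv hdreal ρ, hdρ, map_zero]
          · simpa using hneg
        · exact ⟨ρ, hρ, hdρ, hpos⟩
      have hfw : iteratedDeriv (j + 1) f w = 0 := by rw [← e1]; exact hdw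
      have hwre : w.re ∈ Ioo (a.re - a.im) (a.re + a.im) := (mem_reProdIm.mp hw).1
      have hwa : |w.re - a.re| < a.im := by rw [abs_lt]; constructor <;> linarith [hwre.1, hwre.2]
      -- Jensen host at level `j`
      obtain ⟨c, hc, hcpos, hdisc⟩ := jensen_host_levelj hf j hnz ha hwpos hfw
      refine Or.inl ⟨w, hfw, hwpos.ne', ?_⟩
      show (w.re - a.re) ^ 2 + w.im ^ 2 ≤ a.im ^ 2
      by_cases hca : c = a
      · rw [hca] at hdisc; exact hdisc
      · have hwc : |w.re - c.re| ≤ c.im := abs_le_of_sq_le_sq (by nlinarith [sq_nonneg w.im]) hcpos.le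
        rcases hJ c hc hcpos hca with hfar | hnest
        · -- far: impossible
          exfalso
          have := abs_sub_le a.re w.re c.re
          rw [abs_sub_comm a.re w.re] at this
          linarith
        · -- nested: the point lies in `c`'s disc, inside `a`'s
          have hD : (w.re - c.re) ^ 2 = |w.re - c.re| ^ 2 := (sq_abs _).symm
          have h1 : |w.re - a.re| ≤ |w.re - c.re| + |c.re - a.re| := abs_sub_le _ _ _
          have h2 : |c.re - a.re| = |a.re - c.re| := abs_sub_comm _ _
          have h0 : 0 ≤ |w.re - c.re| := abs_nonneg _
          have h0' : 0 ≤ |a.re - c.re| := abs_nonneg _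
          have h3 : (w.re - a.re) ^ 2 = |w.re - a.re| ^ 2 := (sq_abs _).symm
          have h4 : |w.re - a.re| ^ 2 ≤ (|w.re - c.re| + |a.re - c.re|) ^ 2 := by
            rw [h2] at h1
            exact pow_le_pow_left₀ (abs_nonneg _) h1 2
          nlinarith [hdisc, h4, hwc, hnest, h0, h0', hcpos, sq_nonneg w.im]
  · obtain ⟨x, hx, hNL⟩ := nlEventOf_of_not_localB hf j hB
    refine Or.inr ⟨x, ?_, hNL⟩
    rw [abs_lt]; constructor <;> linarith [hx.1, hx.2]

/-- ★ `TopPinning` IN THE JENSEN-ISOLATED CASE (literal conclusion of the law; `NoTallerToucher` is implied, `noTallerToucher_of_jensenIsolated`). -/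
theorem topPinning_case_jensenIsolated {η : ℝ} {f : ℂ → ℂ} {x₀ s hmax R Hs : ℝ} {B : ℕ} (hE : EngineHyps5 2 η f x₀ s hmax R Hs B)
    {j : ℕ} {a : ℂ} (ha : iteratedDeriv j f a = 0) (hapos : 0 < a.im) (hJ : JensenIsolated f j a) (hF : CleanFeet f j a) :
    (∃ w : ℂ, iteratedDeriv (j + 1) f w = 0 ∧ w.im ≠ 0 ∧ NestedStep a w) ∨ (∃ x : ℝ, |x - a.re| ≤ a.im ∧ NLEventOf f j x) := by
  rcases pinning_of_jensenIsolated hE ha hapos hJ hF with h | ⟨x, hx, hNL⟩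
  · exact Or.inl h
  · exact Or.inr ⟨x, hx.le, hNL⟩

/-! ## §1b DIRTY FEET REMOVED — generic δ-shifted windows (uniform far gap + finitely many zeros of `G·G′` and NL events near the feet)

The clean-feet hypothesis of §1 is an artefact of the window's corners.  Shift both feet lines outward by a GENERIC `ε > 0` smaller than
the UNIFORM slack `g` of the strictly-far zeros (`exists_uniform_far_gap`, after `RhW08.SuccB.exists_uniform_gap`) and than the NL MARGIN `m`
(`exists_nl_margin`: finitely many NL events near the base, so an NL event within `Im a + m` of `Re a` is within `Im a`): the shifted corners miss the
finitely many zeros of `f^{(j)}`, `f^{(j+1)}` in the box (`RhW08.SuccB.finite_zeros_box`, `Set.Ioo_infinite`), the sides are (strictly) clear, and the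
§1 argument runs verbatim; the conclusion is the LITERAL `TopPinning` disjunction (closed disc / closed base). -/

/-- UNIFORM SLACK of the STRICTLY FAR non-real zeros of an entire `G ≢ 0` (zeros in `|Im| ≤ Hs`) from the closed disc of `a` — hypothesis-free:
only zeros that ARE strictly far are quantified (finitely many in the box `|Re c − Re a| < Im a + Hs + 2`; slack `≥ 1` outside). -/
theorem exists_uniform_far_gap {G : ℂ → ℂ} (hG : Differentiable ℂ G) (hne : G ≠ 0) {Hs : ℝ}
    (hstrip : ∀ c : ℂ, G c = 0 → |c.im| ≤ Hs) {a : ℂ} (haim : 0 < a.im) (haHs : a.im ≤ Hs) :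
    ∃ g : ℝ, 0 < g ∧ g ≤ 1 ∧
      ∀ c : ℂ, G c = 0 → a.im + |c.im| < |a.re - c.re| → a.im + |c.im| + g ≤ |a.re - c.re| := by
  have hHs : 0 ≤ Hs := le_trans haim.le haHs
  set L : ℝ := a.im + Hs + 2 with hL
  have hz₀ : ((a.re : ℂ)) ∈ Ioo (a.re - L) (a.re + L) ×ℂ Ioo (-(Hs + 1)) (Hs + 1) :=
    ofReal_mem_box (by rw [sub_self, abs_zero]; linarith) hHs
  have hfin := finite_zeros_box hG hne hz₀
  have hout : ∀ c : ℂ, G c = 0 → c ∉ Ioo (a.re - L) (a.re + L) ×ℂ Ioo (-(Hs + 1)) (Hs + 1) →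
      a.im + |c.im| + 1 ≤ |a.re - c.re| := by
    intro c hGc hbox
    have hci : |c.im| ≤ Hs := hstrip c hGc
    have hre : L ≤ |a.re - c.re| := by
      by_contra hlt
      rw [not_le] at hlt
      apply hbox
      rw [mem_reProdIm]
      rw [abs_lt] at hlt
      rw [abs_le] at hci
      exact ⟨⟨by linarith, by linarith⟩, ⟨by linarith, by linarith⟩⟩
    linarith
  set T : Set ℂ := {c : ℂ | G c = 0 ∧ c ∈ Ioo (a.re - L) (a.re + L) ×ℂ Ioo (-(Hs + 1)) (Hs + 1)} ∩
    {c : ℂ | a.im + |c.im| < |a.re - c.re|} with hT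
  have hTfin : T.Finite := hfin.inter_of_left _
  let sl : ℂ → ℝ := fun c => |a.re - c.re| - a.im - |c.im|
  by_cases hTe : T.Nonempty
  · obtain ⟨c₀, hc₀, hmin⟩ := Set.exists_min_image T sl hTfin hTe
    have hsl₀ : 0 < sl c₀ := by
      have h := hc₀.2
      simp only [Set.mem_setOf_eq] at h
      show 0 < |a.re - c₀.re| - a.im - |c₀.im|
      linarith
    refine ⟨min (sl c₀) 1, lt_min hsl₀ one_pos, min_le_right _ _, ?_⟩
    intro c hGc hfar
    by_cases hbox : c ∈ Ioo (a.re - L) (a.re + L) ×ℂ Ioo (-(Hs + 1)) (Hs + 1)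
    · have hcT : c ∈ T := ⟨⟨hGc, hbox⟩, hfar⟩
      have h1 : sl c₀ ≤ sl c := hmin c hcT
      have h2 : min (sl c₀) 1 ≤ sl c₀ := min_le_left _ _
      have h3 : sl c = |a.re - c.re| - a.im - |c.im| := rfl
      linarith
    · have h1 := hout c hGc hbox
      have h2 : min (sl c₀) 1 ≤ 1 := min_le_right _ _
      linarith
  · refine ⟨1, one_pos, le_rfl, ?_⟩
    intro c hGc hfar
    by_cases hbox : c ∈ Ioo (a.re - L) (a.re + L) ×ℂ Ioo (-(Hs + 1)) (Hs + 1)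
    · exact absurd ⟨c, ⟨hGc, hbox⟩, hfar⟩ hTe
    · exact hout c hGc hbox

/-- NL MARGIN: the NL events of level `j` near the base of `a` are finitely many (zeros of `f^{(j+1)} ≢ 0` in a box), so there is
`m ∈ (0, 1]` such that an NL event with `|x − Re a| < Im a + m` already has `|x − Re a| ≤ Im a`. -/
theorem exists_nl_margin {f : ℂ → ℂ} (hf : RealEntireLt2 f) {j : ℕ} (hne : iteratedDeriv (j + 1) f ≠ 0) {a : ℂ} (ha : 0 < a.im) :
    ∃ m : ℝ, 0 < m ∧ m ≤ 1 ∧ ∀ x : ℝ, NLEventOf f j x → |x - a.re| < a.im + m → |x - a.re| ≤ a.im := by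
  have hG'd : Differentiable ℂ (iteratedDeriv (j + 1) f) := differentiable_iteratedDeriv_of_entire hf.diff (j + 1)
  set L : ℝ := a.im + 1 with hL
  have hz₀ : ((a.re : ℂ)) ∈ Ioo (a.re - L) (a.re + L) ×ℂ Ioo (-((0 : ℝ) + 1)) ((0 : ℝ) + 1) :=
    ofReal_mem_box (by rw [sub_self, abs_zero]; linarith) le_rfl
  have hfin := finite_zeros_box hG'd hne hz₀
  set N : Set ℝ := {x : ℝ | NLEventOf f j x ∧ |x - a.re| < a.im + 1 ∧ a.im < |x - a.re|} with hN
  have hNfin : N.Finite := by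
    refine (hfin.preimage Complex.ofReal_injective.injOn).subset ?_
    intro x hx
    refine ⟨?_, ofReal_mem_box (by linarith [hx.2.1] : |x - a.re| < L) le_rfl⟩
    have hre : (iteratedDeriv (j + 1) f (x : ℂ)).re = 0 := hx.1.1
    have him : (iteratedDeriv (j + 1) f (x : ℂ)).im = 0 := im_iteratedDeriv_ofReal hf.diff hf.real (j + 1) x
    exact Complex.ext (by simpa using hre) (by simpa using him)
  by_cases hNe : N.Nonempty
  · obtain ⟨x₁, hx₁, hmin⟩ := Set.exists_min_image N (fun x => |x - a.re| - a.im) hNfin hNe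
    have hm₀ : 0 < |x₁ - a.re| - a.im := by linarith [hx₁.2.2]
    refine ⟨min (|x₁ - a.re| - a.im) 1, lt_min hm₀ one_pos, min_le_right _ _, ?_⟩
    intro x hNL hx
    by_contra hgt
    rw [not_le] at hgt
    have hxN : x ∈ N := ⟨hNL, by linarith [min_le_right (|x₁ - a.re| - a.im) 1], hgt⟩
    have h1 : |x₁ - a.re| - a.im ≤ |x - a.re| - a.im := hmin x hxN
    linarith [min_le_left (|x₁ - a.re| - a.im) 1]
  · refine ⟨1, one_pos, le_rfl, ?_⟩
    intro x hNL hx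
    by_contra hgt
    rw [not_le] at hgt
    exact hNe ⟨x, hNL, hx, hgt⟩

/-- Clearance of the SHIFTED foot lines `Re = Re a ± t`, `Im a ≤ t < Im a + g` (`g` a uniform far gap), from every non-real zero of
`f^{(j)}` of a JENSEN-ISOLATED `a` (strict except for the trivial `≤`). -/
theorem shifted_clear {f : ℂ → ℂ} {j : ℕ} {a : ℂ} (hGreal : ∀ z : ℂ, iteratedDeriv j f (conj z) = conj (iteratedDeriv j f z))
    (hapos : 0 < a.im) (hJ : JensenIsolated f j a) {g t : ℝ}
    (hgap : ∀ c : ℂ, iteratedDeriv j f c = 0 → a.im + |c.im| < |a.re - c.re| → a.im + |c.im| + g ≤ |a.re - c.re|)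
    (hat : a.im ≤ t) (htg : t < a.im + g) {σ : ℝ} (hσ : σ = 1 ∨ σ = -1) :
    ∀ c : ℂ, iteratedDeriv j f c = 0 → c.im ≠ 0 → |c.im| ≤ |(a.re + σ * t) - c.re| := by
  intro c hc hcim
  obtain ⟨c', hc', hc'pos, hc're, hc'im⟩ : ∃ c' : ℂ, iteratedDeriv j f c' = 0 ∧ 0 < c'.im ∧ c'.re = c.re ∧ c'.im = |c.im| := by
    rcases lt_or_gt_of_ne hcim with hneg | hpos
    · refine ⟨conj c, by rw [hGreal, hc, map_zero], by simpa using hneg, by simp, ?_⟩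
      rw [Complex.conj_im, abs_of_neg hneg]
    · exact ⟨c, hc, hpos, rfl, (abs_of_pos hpos).symm⟩
  have htpos : 0 < t := lt_of_lt_of_le hapos hat
  have hσabs : |σ * t| = t := by
    rcases hσ with h | h <;> simp [h, abs_of_pos htpos]
  by_cases hca : c' = a
  · have hre : c.re = a.re := by rw [← hc're, hca]
    have him : |c.im| = a.im := by rw [← hc'im, hca]
    rw [him, hre, show a.re + σ * t - a.re = σ * t by ring, hσabs]
    exact hat
  · rcases hJ c' hc' hc'pos hca with hfar | hnest
    · -- strictly far ⇒ uniform gap `g`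
      rw [hc're, hc'im] at hfar
      have hg' := hgap c hc hfar
      have htri : |a.re - c.re| ≤ |a.re + σ * t - c.re| + |σ * t| := by
        have h := abs_sub (a.re + σ * t - c.re) (σ * t)
        rwa [show a.re + σ * t - c.re - σ * t = a.re - c.re by ring] at h
      rw [hσabs] at htri
      linarith
    · -- strictly nested
      rw [hc're, hc'im] at hnest
      have htri : t ≤ |a.re + σ * t - c.re| + |a.re - c.re| := by
        have h := abs_add_le (a.re + σ * t - c.re) (-(a.re - c.re))
        have e : a.re + σ * t - c.re + -(a.re - c.re) = σ * t := by ring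
        rw [e, hσabs, abs_neg] at h
        exact h
      linarith

/-- ★★★ WALSH–JENSEN PINNING, DIRTY FEET ALLOWED (the literal `TopPinning` conclusion on the Jensen-isolated population, NO smallness,
NO cleanliness): a JENSEN-ISOLATED upper zero `a` of `f^{(j)}` on a legal frame has a non-real zero of `f^{(j+1)}` in its CLOSED Jensen disc
or an NL event of level `j` in the CLOSED base `|x − Re a| ≤ Im a`. -/
theorem pinning_of_jensenIsolated' {η : ℝ} {f : ℂ → ℂ} {x₀ s hmax R Hs : ℝ} {B : ℕ} (hE : EngineHyps5 2 η f x₀ s hmax R Hs B)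
    {j : ℕ} {a : ℂ} (ha : iteratedDeriv j f a = 0) (hapos : 0 < a.im) (hJ : JensenIsolated f j a) :
    (∃ w : ℂ, iteratedDeriv (j + 1) f w = 0 ∧ w.im ≠ 0 ∧ NestedStep a w) ∨ (∃ x : ℝ, |x - a.re| ≤ a.im ∧ NLEventOf f j x) := by
  classical
  have hf : RealEntireLt2 f := realEntireLt2_of_hyps hE
  have hnz : iteratedDeriv j f ≠ 0 := ne_zero_of_jensenIsolated hapos hJ
  set G : ℂ → ℂ := iteratedDeriv j f with hGdef
  have hG : RealEntireLt2 G :=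
    { diff := differentiable_iteratedDeriv_of_entire hf.diff j
      growth := by
        obtain ⟨ρ, C, hρ0, hρ, hgr⟩ := hf.growth
        obtain ⟨ρ', C', h1, h2, h3⟩ := exists_growth_iteratedDeriv hf.diff hρ0 hρ hgr j
        exact ⟨ρ', C', h1, h2, h3⟩
      real := im_iteratedDeriv_ofReal hf.diff hf.real j }
  have hGreal : ∀ z : ℂ, G (conj z) = conj (G z) := apply_conj_eq_conj hG.diff hG.real
  have e1 : deriv G = iteratedDeriv (j + 1) f := by rw [hGdef, ← iteratedDeriv_succ]
  have hHs : 0 ≤ Hs := hE.2.2.2.2.2.2.2.1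
  have hstrip : ∀ c : ℂ, G c = 0 → |c.im| ≤ Hs := fun c hc => abs_im_le_of_level hE hnz hc
  have haHs : a.im ≤ Hs := by have := hstrip a ha; rwa [abs_of_pos hapos] at this
  have hGd : Differentiable ℂ G := hG.diff
  have hG'ne : iteratedDeriv (j + 1) f ≠ 0 := iteratedDeriv_succ_ne_zero_of_zero hf.diff j hnz ha
  have hG'd : Differentiable ℂ (iteratedDeriv (j + 1) f) := differentiable_iteratedDeriv_of_entire hf.diff (j + 1)
  -- the uniform far gap `g` and the NL margin `m`
  obtain ⟨g, hg0, hg1, hgap⟩ := exists_uniform_far_gap hGd hnz hstrip hapos haHs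
  obtain ⟨m, hm0, hm1, hmarg⟩ := exists_nl_margin hf hG'ne hapos (a := a)
  set ε₀ : ℝ := min g m with hε₀
  have hε₀0 : 0 < ε₀ := lt_min hg0 hm0
  -- finitely many zeros of `G`, `G'` in the box ⇒ a GENERIC shift `ε ∈ (0, ε₀)` keeps the four corners clean
  set L : ℝ := a.im + Hs + 2 with hL
  have hz₀ : ((a.re : ℂ)) ∈ Ioo (a.re - L) (a.re + L) ×ℂ Ioo (-(Hs + 1)) (Hs + 1) :=
    ofReal_mem_box (by rw [sub_self, abs_zero]; linarith) hHs
  set Z : Set ℂ := {ρ : ℂ | G ρ = 0 ∧ ρ ∈ Ioo (a.re - L) (a.re + L) ×ℂ Ioo (-(Hs + 1)) (Hs + 1)} ∪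
    {ρ : ℂ | iteratedDeriv (j + 1) f ρ = 0 ∧ ρ ∈ Ioo (a.re - L) (a.re + L) ×ℂ Ioo (-(Hs + 1)) (Hs + 1)} with hZ
  have hZfin : Z.Finite := (finite_zeros_box hGd hnz hz₀).union (finite_zeros_box hG'd hG'ne hz₀)
  let cp : ℝ → ℂ := fun ε => ((a.re + (a.im + ε) : ℝ) : ℂ)
  let cm : ℝ → ℂ := fun ε => ((a.re - (a.im + ε) : ℝ) : ℂ)
  have hcp : Set.InjOn cp (cp ⁻¹' Z) := fun x _ y _ h => by
    have h' : a.re + (a.im + x) = a.re + (a.im + y) := Complex.ofReal_inj.mp h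
    linarith
  have hcm : Set.InjOn cm (cm ⁻¹' Z) := fun x _ y _ h => by
    have h' : a.re - (a.im + x) = a.re - (a.im + y) := Complex.ofReal_inj.mp h
    linarith
  have hbad : (cp ⁻¹' Z ∪ cm ⁻¹' Z).Finite := (hZfin.preimage hcp).union (hZfin.preimage hcm)
  obtain ⟨ε, hεI, hεbad⟩ := ((Set.Ioo_infinite hε₀0).sdiff hbad).nonempty
  obtain ⟨hε0, hε1⟩ := hεI
  have hεg : ε < g := lt_of_lt_of_le hε1 (min_le_left _ _)
  have hεm : ε < m := lt_of_lt_of_le hε1 (min_le_right _ _)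
  have hat : a.im ≤ a.im + ε := by linarith
  have htg : a.im + ε < a.im + g := by linarith
  have hβmem : cp ε ∈ Ioo (a.re - L) (a.re + L) ×ℂ Ioo (-(Hs + 1)) (Hs + 1) :=
    ofReal_mem_box (by rw [show a.re + (a.im + ε) - a.re = a.im + ε by ring, abs_of_pos (by linarith)]; linarith) hHs
  have hαmem : cm ε ∈ Ioo (a.re - L) (a.re + L) ×ℂ Ioo (-(Hs + 1)) (Hs + 1) :=
    ofReal_mem_box (by rw [show a.re - (a.im + ε) - a.re = -(a.im + ε) by ring, abs_neg, abs_of_pos (by linarith)]; linarith) hHs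
  have hGβ : G (cp ε) ≠ 0 := fun h0 => hεbad (Or.inl (Or.inl ⟨h0, hβmem⟩))
  have hG'β : iteratedDeriv (j + 1) f (cp ε) ≠ 0 := fun h0 => hεbad (Or.inl (Or.inr ⟨h0, hβmem⟩))
  have hGα : G (cm ε) ≠ 0 := fun h0 => hεbad (Or.inr (Or.inl ⟨h0, hαmem⟩))
  have hG'α : iteratedDeriv (j + 1) f (cm ε) ≠ 0 := fun h0 => hεbad (Or.inr (Or.inr ⟨h0, hαmem⟩))
  -- the shifted square window is a Jensen window
  have hclL : ∀ c : ℂ, G c = 0 → c.im ≠ 0 → |c.im| ≤ |(a.re - (a.im + ε)) - c.re| := by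
    have h := shifted_clear (f := f) (j := j) hGreal hapos hJ hgap hat htg (σ := -1) (Or.inr rfl)
    intro c hc hcim
    have h1 := h c hc hcim
    rwa [show a.re + -1 * (a.im + ε) = a.re - (a.im + ε) by ring] at h1
  have hclR : ∀ c : ℂ, G c = 0 → c.im ≠ 0 → |c.im| ≤ |(a.re + (a.im + ε)) - c.re| := by
    have h := shifted_clear (f := f) (j := j) hGreal hapos hJ hgap hat htg (σ := 1) (Or.inl rfl)
    intro c hc hcim
    have h1 := h c hc hcim
    rwa [show a.re + 1 * (a.im + ε) = a.re + (a.im + ε) by ring] at h1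
  have hW : Window G (a.re - (a.im + ε)) (a.re + (a.im + ε)) (Hs + 1) := by
    refine ⟨by linarith, by linarith, ?_, ?_, ?_, hGα, hGβ, ?_, ?_⟩
    · exact fun x _ => jensenClear_top (by linarith) (by linarith) hstrip
    · exact fun y _ hy0 => jensenClear_vline hy0 hclL
    · exact fun y _ hy0 => jensenClear_vline hy0 hclR
    · rw [e1]; exact hG'α
    · rw [e1]; exact hG'β
  have hamem : a ∈ Ioo (a.re - (a.im + ε)) (a.re + (a.im + ε)) ×ℂ Ioo (-(Hs + 1)) (Hs + 1) :=
    mem_reProdIm.2 ⟨⟨by linarith, by linarith⟩, ⟨by linarith, by linarith⟩⟩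
  by_cases hB : LocalB G (a.re - (a.im + ε)) (a.re + (a.im + ε))
  · by_cases hA : LocalA G (a.re - (a.im + ε)) (a.re + (a.im + ε)) (Hs + 1)
    · exact absurd (no_nonreal_zero_of_localA_localB hG hW hA hB a hamem ha) hapos.ne'
    · unfold LocalA at hA
      push Not at hA
      obtain ⟨ρ, hρ, hdρ, hρim⟩ := hA
      have hdreal : ∀ x : ℝ, (deriv G x).im = 0 := im_deriv_ofReal hG.diff hG.real
      obtain ⟨w, hw, hdw, hwpos⟩ : ∃ w ∈ Ioo (a.re - (a.im + ε)) (a.re + (a.im + ε)) ×ℂ Ioo (-(Hs + 1)) (Hs + 1),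
          deriv G w = 0 ∧ 0 < w.im := by
        rcases lt_or_gt_of_ne hρim with hneg | hpos
        · refine ⟨conj ρ, ?_, ?_, ?_⟩
          · rw [mem_reProdIm] at hρ ⊢
            obtain ⟨h1, h2, h3⟩ := hρ
            refine ⟨by simpa using h1, ?_, ?_⟩
            · simp only [Complex.conj_im]; linarith [h3]
            · simp only [Complex.conj_im]; linarith [h2]
          · rw [apply_conj_eq_conj hG.diff.deriv hdreal ρ, hdρ, map_zero]
          · simpa using hneg
        · exact ⟨ρ, hρ, hdρ, hpos⟩
      have hfw : iteratedDeriv (j + 1) f w = 0 := by rw [← e1]; exact hdw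
      have hwre : w.re ∈ Ioo (a.re - (a.im + ε)) (a.re + (a.im + ε)) := (mem_reProdIm.mp hw).1
      have hwa : |w.re - a.re| < a.im + ε := by rw [abs_lt]; constructor <;> linarith [hwre.1, hwre.2]
      obtain ⟨c, hc, hcpos, hdisc⟩ := jensen_host_levelj hf j hnz ha hwpos hfw
      refine Or.inl ⟨w, hfw, hwpos.ne', ?_⟩
      show (w.re - a.re) ^ 2 + w.im ^ 2 ≤ a.im ^ 2
      by_cases hca : c = a
      · rw [hca] at hdisc; exact hdisc
      · have hwc : |w.re - c.re| ≤ c.im := abs_le_of_sq_le_sq (by nlinarith [sq_nonneg w.im]) hcpos.le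
        rcases hJ c hc hcpos hca with hfar | hnest
        · -- far: impossible by the UNIFORM gap (`ε < g`)
          exfalso
          have hfar' : a.im + |c.im| < |a.re - c.re| := by rwa [abs_of_pos hcpos]
          have hg' := hgap c hc hfar'
          rw [abs_of_pos hcpos] at hg'
          have := abs_sub_le a.re w.re c.re
          rw [abs_sub_comm a.re w.re] at this
          linarith
        · -- nested: `D̄(c) ⊂ D(a)`
          have h1 : |w.re - a.re| ≤ |w.re - c.re| + |c.re - a.re| := abs_sub_le _ _ _
          have h2 : |c.re - a.re| = |a.re - c.re| := abs_sub_comm _ _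
          have h0 : 0 ≤ |w.re - c.re| := abs_nonneg _
          have h0' : 0 ≤ |a.re - c.re| := abs_nonneg _
          have h3 : (w.re - a.re) ^ 2 = |w.re - a.re| ^ 2 := (sq_abs _).symm
          have h3' : (w.re - c.re) ^ 2 = |w.re - c.re| ^ 2 := (sq_abs _).symm
          have h4 : |w.re - a.re| ^ 2 ≤ (|w.re - c.re| + |a.re - c.re|) ^ 2 := by
            rw [h2] at h1
            exact pow_le_pow_left₀ (abs_nonneg _) h1 2
          have h5 : (|w.re - c.re| + |a.re - c.re|) ^ 2 + w.im ^ 2 ≤ (c.im + |a.re - c.re|) ^ 2 := by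
            rw [h3'] at hdisc
            nlinarith [hdisc, hwc, h0, h0', hcpos.le]
          have h6pos : 0 < c.im + |a.re - c.re| := by positivity
          have h6 : (c.im + |a.re - c.re|) ^ 2 < a.im ^ 2 := by
            have hlt : c.im + |a.re - c.re| < a.im := by linarith
            nlinarith [hlt, h6pos, hapos]
          linarith [h3, h4, h5, h6, sq_nonneg w.im]
  · obtain ⟨x, hx, hNL⟩ := nlEventOf_of_not_localB hf j hB
    have hxa : |x - a.re| < a.im + m := by
      rw [abs_lt]; constructor <;> linarith [hx.1, hx.2]
    exact Or.inr ⟨x, hmarg x hNL hxa, hNL⟩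

/-- The CROSSING-MATE residual of the law: `TopPinning` restricted to NON-isolated zeros (under `NoTallerToucher` this means: some
lower-or-equal mate's circle crosses or touches `a`'s, `residual_of_not_jensenIsolated`).  OPEN statement. -/
def TopPinningCrossing : Prop :=
  ∀ (η : ℝ) (f : ℂ → ℂ) (x₀ s hmax R Hs : ℝ) (B : ℕ), EngineHyps5 2 η f x₀ s hmax R Hs B → ∀ (j : ℕ) (a : ℂ),
    iteratedDeriv j f a = 0 → 0 < a.im → NoTallerToucher f j a → ¬ JensenIsolated f j a →
    (∃ w : ℂ, iteratedDeriv (j + 1) f w = 0 ∧ w.im ≠ 0 ∧ NestedStep a w) ∨ (∃ x : ℝ, |x - a.re| ≤ a.im ∧ NLEventOf f j x)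

/-- ★ REDUCTION OF THE LAW TO ITS RESIDUAL (exact split): `TopPinning ⟸ TopPinningCrossing` — the Jensen-isolated population is a theorem. -/
theorem topPinning_of_crossing (hC : TopPinningCrossing) : TopPinning := by
  intro η f x₀ s hmax R Hs B hE j a ha hapos hN
  by_cases hJ : JensenIsolated f j a
  · exact pinning_of_jensenIsolated' hE ha hapos hJ
  · exact hC η f x₀ s hmax R Hs B hE j a ha hapos hN hJ

/-- Converse (bookkeeping): the split is exact. -/
theorem crossing_of_topPinning (hP : TopPinning) : TopPinningCrossing :=
  fun η f x₀ s hmax R Hs B hE j a ha hapos hN _ => hP η f x₀ s hmax R Hs B hE j a ha hapos hN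

/-! ## §2 WEAK-FIELD PINNING: the isolated simple pair with a small cofactor field (closed-disc port of `tilt_of_isolated_circle`) -/

/-- `q(z) = (z − a)² + b² ≠ 0` on any circle `‖z − a‖ = r` with `r ≠ |b|`. -/
theorem pairQ_ne_zero_of_ne {a b r : ℝ} (hrb : r ≠ |b|) {z : ℂ} (hz : ‖z - a‖ = r) : pairQ a b z ≠ 0 := by
  intro h0
  have h1 : (z - a) ^ 2 = -((b : ℂ) ^ 2) := by unfold pairQ at h0; linear_combination h0
  have h2 : ‖z - a‖ ^ 2 = |b| ^ 2 := by
    have := congrArg norm h1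
    rw [norm_pow, norm_neg, norm_pow, Complex.norm_real, Real.norm_eq_abs] at this
    exact this
  rw [hz] at h2
  have hr0 : 0 ≤ r := hz ▸ norm_nonneg _
  exact hrb ((sq_eq_sq₀ hr0 (abs_nonneg b)).1 h2)

/-- CIRCLE CLAUSE from a cofactor-field bound at ANY radius `r ≠ |b|` (the tree's `hcirc_of_cofactor_bound` needs `|b| < r`). -/
theorem hcirc_of_cofactor_bound' {G : ℂ → ℂ} {a b r L : ℝ} (hrb : r ≠ |b|)
    (hL : ∀ z : ℂ, ‖z - a‖ = r → ‖deriv G z / G z - 2 * (z - a) / pairQ a b z‖ ≤ L)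
    (hrL : (r ^ 2 + b ^ 2) * L < 2 * r) :
    ∀ z : ℂ, ‖z - a‖ = r → ‖pairQ a b z * (deriv G z / G z) - 2 * (z - a)‖ < 2 * r := by
  intro z hz
  have hq := pairQ_ne_zero_of_ne hrb hz
  have key : pairQ a b z * (deriv G z / G z) - 2 * (z - a) = pairQ a b z * (deriv G z / G z - 2 * (z - a) / pairQ a b z) := by
    field_simp
  rw [key, norm_mul]
  have hLz := hL z hz
  have h0 : 0 ≤ L := (norm_nonneg _).trans hLz
  calc ‖pairQ a b z‖ * ‖deriv G z / G z - 2 * (z - a) / pairQ a b z‖ ≤ (r ^ 2 + b ^ 2) * L :=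
        mul_le_mul (norm_pairQ_le_of_circle hz) hLz (norm_nonneg _) (by positivity)
    _ < 2 * r := hrL

/-- ★★ WEAK-FIELD PINNING: `f` real, `G := f^{(j)}` holomorphic on `ball a ρ`, a SIMPLE zero `a + ib` (`0 < b < ρ`) with `a ± ib` the only zeros
of `G` in the ball, cofactor field `‖G′/G − 2(z − a)/q‖ ≤ L` on the punctured ball, and the exact smallness `b·L < 1` ⇒ an NL event `x` with
`|x − a| < b` (INSIDE the closed axis disc).  Rouché radius `r = b(1 + bL)/2 ∈ [b/2, b)`: `(r² + b²)L ≤ (r + b)·bL < 2r`. -/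
theorem nl_in_disc_of_weakField {f : ℂ → ℂ} {j : ℕ} {a b ρ L : ℝ}
    (hf : ∀ z : ℂ, f (conj z) = conj (f z))
    (hD : DifferentiableOn ℂ (iteratedDeriv j f) (ball (a : ℂ) ρ))
    (hb : 0 < b) (hbρ : b < ρ)
    (hz : iteratedDeriv j f (a + b * I) = 0) (hz' : deriv (iteratedDeriv j f) (a + b * I) ≠ 0)
    (honly : ∀ z ∈ ball (a : ℂ) ρ, iteratedDeriv j f z = 0 → z = a + b * I ∨ z = a - b * I)
    (hL : ∀ z ∈ ball (a : ℂ) ρ, iteratedDeriv j f z ≠ 0 →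
      ‖deriv (iteratedDeriv j f) z / iteratedDeriv j f z - 2 * (z - a) / pairQ a b z‖ ≤ L)
    (hweak : b * L < 1) :
    ∃ x : ℝ, |x - a| < b ∧ NLEventOf f j x := by
  have hGreal := Literature.NumberTheory.LFunctions.iteratedDeriv_conj_of_conj hf j
  have hbρ' : |b| < ρ := by rw [abs_of_pos hb]; exact hbρ
  obtain ⟨h, hh, hh0, hG⟩ := exists_pair_factor_real hGreal hb.ne' hbρ' hD hz hz' honly
  -- `0 ≤ L` (the centre `a` is in the punctured ball)
  have hL0 : 0 ≤ L := by
    have hamem : (a : ℂ) ∈ ball (a : ℂ) ρ := mem_ball_self (hb.trans hbρ)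
    have hGa : iteratedDeriv j f a ≠ 0 := by
      intro h0
      rcases honly a hamem h0 with h1 | h1
      · have := congrArg Complex.im h1; simp at this; exact hb.ne' this.symm
      · have := congrArg Complex.im h1; simp at this; exact hb.ne' (by linarith)
    exact (norm_nonneg _).trans (hL a hamem hGa)
  -- the inner radius
  set t : ℝ := b * L with ht
  have ht0 : 0 ≤ t := by positivity
  set r : ℝ := b * (1 + t) / 2 with hr
  have hr0 : 0 < r := by positivity
  have hrb : r < b := by rw [hr]; nlinarith
  have hrρ : r < ρ := hrb.trans hbρ
  have hrL : (r ^ 2 + b ^ 2) * L < 2 * r := by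
    have e1 : r * L ≤ t := by rw [ht]; exact mul_le_mul_of_nonneg_right hrb.le hL0
    have e2 : (r ^ 2 + b ^ 2) * L = r * (r * L) + b * t := by rw [ht]; ring
    have e3 : r * (r * L) ≤ r * t := mul_le_mul_of_nonneg_left e1 hr0.le
    have e4 : t * (r + b) < 2 * r := by rw [hr]; nlinarith
    nlinarith
  have hrb' : r ≠ |b| := by rw [abs_of_pos hb]; exact hrb.ne
  -- circle clause at radius `r`
  have hcirc : ∀ z : ℂ, ‖z - a‖ = r →
      ‖pairQ a b z * (deriv (iteratedDeriv j f) z / iteratedDeriv j f z) - 2 * (z - a)‖ < 2 * r := by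
    refine hcirc_of_cofactor_bound' hrb' ?_ hrL
    intro z hzr
    have hzball : z ∈ ball (a : ℂ) ρ := by rw [mem_ball, dist_eq_norm]; linarith
    refine hL z hzball ?_
    intro hG0
    rcases honly z hzball hG0 with h1 | h1
    · have : ‖z - (a : ℂ)‖ = b := by
        rw [h1, show (a : ℂ) + b * I - a = b * I by ring, norm_mul, Complex.norm_I, mul_one, Complex.norm_real,
          Real.norm_eq_abs, abs_of_pos hb]
      linarith
    · have : ‖z - (a : ℂ)‖ = b := by
        rw [h1, show (a : ℂ) - b * I - a = -(b * I) by ring, norm_neg, norm_mul, Complex.norm_I, mul_one, Complex.norm_real,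
          Real.norm_eq_abs, abs_of_pos hb]
      linarith
  have hq : ∀ z : ℂ, ‖z - a‖ = r → pairQ a b z ≠ 0 := fun z hzr => pairQ_ne_zero_of_ne hrb' hzr
  have hsmall := hsmall_of_logDeriv hrρ hh hh0 hG hq hcirc
  obtain ⟨x, hxa, h1, h2, h3⟩ :=
    tilt_of_isolated_circle hr0 hrρ hb hh hh0 hG hsmall hGreal (hreal_of_conjSym hb.ne' hrρ.le hG hGreal)
  refine ⟨x, hxa.trans hrb, ?_, h2, ?_⟩
  · rw [iteratedDeriv_succ, h1]; simp
  · have e : iteratedDeriv (j + 2) f = deriv (deriv (iteratedDeriv j f)) := by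
      rw [show j + 2 = (j + 1) + 1 from rfl, iteratedDeriv_succ, iteratedDeriv_succ]
    rw [e]; exact h3

/-- ★ `TopPinning` IN THE WEAK-FIELD CASE (literal conclusion of the law, for an upper zero `a : ℂ`): the isolated simple pair `{a, ā}` in
`ball (Re a) ρ` with cofactor field `≤ L` and `Im a · L < 1` has an NL event in the closed axis disc. -/
theorem topPinning_case_weakField {f : ℂ → ℂ} {j : ℕ} {a : ℂ} {ρ L : ℝ}
    (hf : ∀ z : ℂ, f (conj z) = conj (f z))
    (hD : DifferentiableOn ℂ (iteratedDeriv j f) (ball (a.re : ℂ) ρ))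
    (hapos : 0 < a.im) (haρ : a.im < ρ)
    (hz : iteratedDeriv j f a = 0) (hz' : iteratedDeriv (j + 1) f a ≠ 0)
    (honly : ∀ z ∈ ball (a.re : ℂ) ρ, iteratedDeriv j f z = 0 → z = a ∨ z = conj a)
    (hL : ∀ z ∈ ball (a.re : ℂ) ρ, iteratedDeriv j f z ≠ 0 →
      ‖deriv (iteratedDeriv j f) z / iteratedDeriv j f z - 2 * (z - a.re) / pairQ a.re a.im z‖ ≤ L)
    (hweak : a.im * L < 1) :
    (∃ w : ℂ, iteratedDeriv (j + 1) f w = 0 ∧ w.im ≠ 0 ∧ NestedStep a w) ∨ (∃ x : ℝ, |x - a.re| ≤ a.im ∧ NLEventOf f j x) := by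
  have ea : (a.re : ℂ) + a.im * I = a := Complex.re_add_im a
  have ea' : (a.re : ℂ) - a.im * I = conj a := by
    apply Complex.ext <;> simp
  have hz1 : iteratedDeriv j f (a.re + a.im * I) = 0 := by rw [ea]; exact hz
  have hz1' : deriv (iteratedDeriv j f) (a.re + a.im * I) ≠ 0 := by rw [ea, ← iteratedDeriv_succ]; exact hz'
  have honly' : ∀ z ∈ ball (a.re : ℂ) ρ, iteratedDeriv j f z = 0 → z = a.re + a.im * I ∨ z = a.re - a.im * I := by
    intro z hzb h0; rw [ea, ea']; exact honly z hzb h0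
  obtain ⟨x, hx, hNL⟩ := nl_in_disc_of_weakField hf hD hapos haρ hz1 hz1' honly' hL hweak
  exact Or.inr ⟨x, hx.le, hNL⟩

end

end RhW08.Lens1PinningIso
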